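import Summits.ValiantsHypothesis.ValiantsHypothesis.Theorems.BarrierLeverChowHitsPartitionMinorsRFacePrivatePrelims

/-!
# Route BarrierLever — item `ChowHitsPartitionMinorsR` (stmt-ValiantsHypothesis-21882):
# the face-private design — the LEADING MATRIX is nonsingular (truncated inverses, triangularity
# along `⊆`)

Helper file (`--supports stmt-ValiantsHypothesis-21882`; cell valiant-natproofs, rung V4, 𝒟-side
support item of route BarrierLever; prover seat val-np-p5 gen 29). Definition-free. Closes NO item.
Third file of the kernel form of THEOREM FP (seat memo MEMO-21882-valnp5-g29.md §6).

SETTING. Rows: an injective family `u : Fin r → Finset (Fin h)` whose range is a lower set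
(`S ⊆ u i ⇒ S = u k` for some `k`). Labels: a permutation `σ` of `Fin r` (column `j` is labelled by the
face `V j = u (σ j)`) and exponents `n j : ℕ` with `n j = 0 ⇒ V j = ∅`. Pure parts
`Q j = (1 − X_{V j})^{n j}` (`X_V = Σ_{a∈V} x_a`). The LEADING MATRIX of the face-private design is
`A[i, j] = coeff_{x^{u i}} ∏_{j' ≠ j} Q j'` (the `t¹`-coefficient of column `j` of the design, file
`…FacePrivateColumns`).

* `exists_one_sub_X_pow_mul_truncInv` — in `R[X]`: `(1 − X)^{d+1} · Σ_{i ≤ k} C(d+i, d) X^i =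
  1 + X^{k+1} · G` (Mathlib's `PowerSeries.mk_add_choose_mul_one_sub_pow_eq_one`, truncated);
* `coeff_partitionExpo_truncInv`, `coeff_partitionExpo_mul_oneSubSumX_pow_mul_truncInv` — the
  truncated inverse `T_{V,d} = Σ_{i ≤ |V|} C(d+i,d) X_V^i` has square-free coefficients
  `C(d+|S|, d) · |S|!` at `S ⊆ V` (zero elsewhere) and `F · (1 − X_V)^{d+1} · T_{V,d}` has the same
  partition coefficients as `F` (the defect is a multiple of `X_V^{|V|+1}`, invisible on
  square-free exponents);
* `det_ne_zero_of_lowerTriangular_subset`, `det_ne_zero_of_upperTriangular_subset` — matrices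
  triangular along `⊆` with nonzero diagonal are nonsingular;
* **`det_leadingMatrix_ne_zero`** — `det A ≠ 0`: `A = M_Q · T` with `M_Q[i,k] = [u k ⊆ u i] ·
  coeff_{x^{u i ∖ u k}} ∏_j Q j` (unitriangular along `⊆`) and `T[k, j] = coeff_{x^{u k}} T_{V j}`
  (supported on `u k ⊆ V j`, nonzero at `u k = V j`).

WHAT THIS IS NOT: no statement about item 21882 yet (assembly in `…FacePrivateDesign`); nothing on
crux stmt-ValiantsHypothesis-14610 or on `VP` versus `VNP`.
-/

set_option linter.dupNamespace false

namespace Summit.ValiantsHypothesis.ValiantsHypothesis.Theorems.BarrierLever.ChowFacePrivate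

open Finset MvPolynomial
open Summit.ValiantsHypothesis.ValiantsHypothesis.Theorems.BarrierLever.BiadditiveDoor
  (coeff_partitionExpo_mul)
open Summit.ValiantsHypothesis.ValiantsHypothesis.Theorems.BarrierLever.ChowFactor
  (coeff_partitionExpo_one)

noncomputable section

variable {h : ℕ}

/-! ## 1. The truncated inverse of `(1 − X)^{d+1}` -/

/-- In `R[X]`: `(1 − X)^{d+1} · Σ_{i ≤ k} C(d+i, d) X^i = 1 + X^{k+1} · G` for some polynomial `G`. -/
theorem exists_one_sub_X_pow_mul_truncInv {R : Type*} [CommRing R] (d k : ℕ) :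
    ∃ G : Polynomial R, (1 - Polynomial.X) ^ (d + 1) *
        (∑ i ∈ Finset.range (k + 1), Polynomial.C (((d + i).choose d : ℕ) : R) * Polynomial.X ^ i) =
      1 + Polynomial.X ^ (k + 1) * G := by
  classical
  set B : Polynomial R := ∑ i ∈ Finset.range (k + 1),
    Polynomial.C (((d + i).choose d : ℕ) : R) * Polynomial.X ^ i with hB
  set q : Polynomial R := (1 - Polynomial.X) ^ (d + 1) * B - 1 with hq
  -- the low coefficients of `q` vanish: compare with the power series inverse
  have hcoeffB : ∀ j, j ≤ k → B.coeff j = (((d + j).choose d : ℕ) : R) := by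
    intro j hj
    rw [hB, Polynomial.finsetSum_coeff]
    simp only [Polynomial.coeff_C_mul, Polynomial.coeff_X_pow]
    rw [Finset.sum_eq_single j]
    · rw [if_pos rfl, mul_one]
    · intro i _ hij; rw [if_neg (Ne.symm hij), mul_zero]
    · intro hj'; exact absurd (Finset.mem_range.mpr (by omega)) hj'
  have hlow : ∀ m, m < k + 1 → q.coeff m = 0 := by
    intro m hm
    have hps : PowerSeries.coeff m (((1 - Polynomial.X) ^ (d + 1) * B : Polynomial R) : PowerSeries R) =
        PowerSeries.coeff m ((1 - PowerSeries.X : PowerSeries R) ^ (d + 1) *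
          PowerSeries.mk fun n => (((d + n).choose d : ℕ) : R)) := by
      rw [Polynomial.coe_mul, Polynomial.coe_pow, Polynomial.coe_sub, Polynomial.coe_one,
        Polynomial.coe_X, PowerSeries.coeff_mul, PowerSeries.coeff_mul]
      refine Finset.sum_congr rfl fun p hp => ?_
      have hp2 : p.2 ≤ k := by
        have := Finset.HasAntidiagonal.mem_antidiagonal.mp hp
        omega
      rw [Polynomial.coeff_coe, PowerSeries.coeff_mk, hcoeffB p.2 hp2]
    have hone : (1 - PowerSeries.X : PowerSeries R) ^ (d + 1) *
        (PowerSeries.mk fun n => (((d + n).choose d : ℕ) : R)) = 1 := by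
      rw [mul_comm]; exact PowerSeries.mk_add_choose_mul_one_sub_pow_eq_one R d
    rw [hq, Polynomial.coeff_sub, Polynomial.coeff_one, ← Polynomial.coeff_coe, hps, hone,
      PowerSeries.coeff_one]
    exact sub_self _
  obtain ⟨G, hG⟩ := (Polynomial.X_pow_dvd_iff).mpr hlow
  refine ⟨G, ?_⟩
  rw [← hG, hq]
  ring

/-! ## 2. The truncated inverse of `(1 − X_V)^{d+1}` in the zeon picture -/

/-- Square-free coefficients of the truncated inverse `Σ_{i ≤ k} C(d+i,d) X_V^i`:
`C(d+|S|, d) · |S|!` at `(S, ∅)` with `S ⊆ V` and `|S| ≤ k`, zero elsewhere. -/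
theorem coeff_partitionExpo_truncInv {R : Type*} [CommRing R] (V : Finset (Fin h)) (d k : ℕ)
    (S T : Finset (Fin h)) :
    coeff (∑ a ∈ S, Finsupp.single (Fin.castAdd h a) 1 + ∑ c ∈ T, Finsupp.single (Fin.natAdd h c) 1)
      (∑ i ∈ Finset.range (k + 1), C ((((d + i).choose d : ℕ) : R)) *
        (∑ a ∈ V, X (Fin.castAdd h a) : MvPolynomial (Fin (h + h)) R) ^ i) =
      if T = ∅ ∧ S ⊆ V ∧ S.card ≤ k then ((((d + S.card).choose d) * S.card.factorial : ℕ) : R)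
      else 0 := by
  classical
  rw [coeff_sum]
  simp only [coeff_C_mul, coeff_partitionExpo_sumX_pow]
  by_cases hc : T = ∅ ∧ S ⊆ V ∧ S.card ≤ k
  · rw [if_pos hc, Finset.sum_eq_single S.card]
    · rw [if_pos ⟨hc.1, hc.2.1, rfl⟩, Nat.cast_mul]
    · intro i _ hi; rw [if_neg (fun hh => hi hh.2.2.symm), mul_zero]
    · intro hS; exact absurd (Finset.mem_range.mpr (Nat.lt_succ_of_le hc.2.2)) hS
  · rw [if_neg hc]
    refine Finset.sum_eq_zero fun i hi => ?_
    rw [if_neg, mul_zero]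
    rintro ⟨hT, hSV, hSi⟩
    exact hc ⟨hT, hSV, by have := Finset.mem_range.mp hi; omega⟩

/-- **The truncated inverse is invisible on square-free exponents**: for `|V| = k`, any `F`, and
`T_{V,d} = Σ_{i ≤ k} C(d+i,d) X_V^i`, the partition coefficients of `F · (1 − X_V)^{d+1} · T_{V,d}`
are those of `F`. -/
theorem coeff_partitionExpo_mul_oneSubSumX_pow_mul_truncInv {R : Type*} [CommRing R]
    (V : Finset (Fin h)) (d : ℕ) (F : MvPolynomial (Fin (h + h)) R) (U T : Finset (Fin h)) :
    coeff (∑ a ∈ U, Finsupp.single (Fin.castAdd h a) 1 + ∑ c ∈ T, Finsupp.single (Fin.natAdd h c) 1)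
      (F * ((1 + C (-1 : R) * ∑ a ∈ V, X (Fin.castAdd h a)) ^ (d + 1) *
        ∑ i ∈ Finset.range (V.card + 1), C ((((d + i).choose d : ℕ) : R)) *
          (∑ a ∈ V, X (Fin.castAdd h a) : MvPolynomial (Fin (h + h)) R) ^ i)) =
    coeff (∑ a ∈ U, Finsupp.single (Fin.castAdd h a) 1 + ∑ c ∈ T, Finsupp.single (Fin.natAdd h c) 1)
      F := by
  classical
  obtain ⟨G, hG⟩ := exists_one_sub_X_pow_mul_truncInv (R := R) d V.card
  -- transport the univariate identity along `X ↦ X_V`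
  have key := congrArg (Polynomial.aeval (∑ a ∈ V, X (Fin.castAdd h a) : MvPolynomial (Fin (h + h)) R)) hG
  simp only [map_mul, map_pow, map_sub, map_add, map_one, map_sum, Polynomial.aeval_X,
    Polynomial.aeval_C, MvPolynomial.algebraMap_eq] at key
  have e1 : (1 + C (-1 : R) * ∑ a ∈ V, X (Fin.castAdd h a) : MvPolynomial (Fin (h + h)) R) =
      1 - ∑ a ∈ V, X (Fin.castAdd h a) := by rw [map_neg, C_1, neg_one_mul, sub_eq_add_neg]
  rw [e1, key, mul_add, mul_one, coeff_add, mul_left_comm]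
  rw [coeff_partitionExpo_mul_eq_zero_of_forall _ _ (fun S T' => ?_), add_zero]
  rw [coeff_partitionExpo_sumX_pow, if_neg]
  rintro ⟨-, hSV, hcard⟩
  have := Finset.card_le_card hSV
  omega

/-! ## 3. Triangularity along `⊆` -/

/-- A matrix whose entry `(i, k)` vanishes unless `u k ⊆ u i`, with nonzero diagonal, for an
injective set family `u`, is nonsingular. -/
theorem det_ne_zero_of_lowerTriangular_subset {K : Type*} [Field K] {r : ℕ}
    (u : Fin r → Finset (Fin h)) (hu : Function.Injective u) (M : Matrix (Fin r) (Fin r) K)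
    (hM : ∀ i k, M i k ≠ 0 → u k ⊆ u i) (hdiag : ∀ i, M i i ≠ 0) : M.det ≠ 0 := by
  classical
  have hinj : Function.Injective fun v => Matrix.vecMul v M := by
    intro c₁ c₂ hc
    rw [← sub_eq_zero]
    set c := c₁ - c₂ with hcdef
    have h0 : ∀ k, ∑ i, c i * M i k = 0 := by
      intro k
      have e' := congr_fun hc k
      simp only [Matrix.vecMul, dotProduct] at e'
      simp only [hcdef, Pi.sub_apply, sub_mul, Finset.sum_sub_distrib]
      exact sub_eq_zero.mpr e'
    -- downward induction on `|u i|`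
    have hind : ∀ n : ℕ, ∀ i, h - (u i).card = n → c i = 0 := by
      intro n
      induction n using Nat.strong_induction_on with
      | _ n ih =>
        intro i hn
        have hsum := h0 i
        rw [← Finset.add_sum_erase _ _ (Finset.mem_univ i)] at hsum
        have hrest : ∑ i' ∈ (Finset.univ : Finset (Fin r)).erase i, c i' * M i' i = 0 := by
          refine Finset.sum_eq_zero fun i' hi' => ?_
          have hne : i' ≠ i := (Finset.mem_erase.mp hi').1
          by_cases hz : M i' i = 0
          · rw [hz, mul_zero]
          · have hsub : u i ⊆ u i' := hM i' i hz
            have hne' : u i ≠ u i' := fun e => hne (hu e).symm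
            have hlt : (u i).card < (u i').card := Finset.card_lt_card (lt_of_le_of_ne hsub hne')
            have hle : (u i').card ≤ h := (Finset.card_le_univ _).trans (Fintype.card_fin h).le
            rw [ih (h - (u i').card) (by omega) i' rfl, zero_mul]
        rw [hrest, add_zero] at hsum
        exact (mul_eq_zero.mp hsum).resolve_right (hdiag i)
    funext i
    exact hind _ i rfl
  have hu' := Matrix.vecMul_injective_iff_isUnit.mp hinj
  exact ((Matrix.isUnit_iff_isUnit_det _).mp hu').ne_zero

/-- A matrix whose entry `(k, j)` vanishes unless `u k ⊆ u (σ j)`, with `M (σ j) j ≠ 0`, for an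
injective set family `u` and a permutation `σ`, is nonsingular. -/
theorem det_ne_zero_of_upperTriangular_subset {K : Type*} [Field K] {r : ℕ}
    (u : Fin r → Finset (Fin h)) (hu : Function.Injective u) (σ : Equiv.Perm (Fin r))
    (M : Matrix (Fin r) (Fin r) K)
    (hM : ∀ k j, M k j ≠ 0 → u k ⊆ u (σ j)) (hdiag : ∀ j, M (σ j) j ≠ 0) : M.det ≠ 0 := by
  classical
  have hinj : Function.Injective fun v => Matrix.mulVec M v := by
    intro c₁ c₂ hc
    rw [← sub_eq_zero]
    set c := c₁ - c₂ with hcdef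
    have h0 : ∀ k, ∑ j, M k j * c j = 0 := by
      intro k
      have e' := congr_fun hc k
      simp only [Matrix.mulVec, dotProduct] at e'
      simp only [hcdef, Pi.sub_apply, mul_sub, Finset.sum_sub_distrib]
      exact sub_eq_zero.mpr e'
    have hind : ∀ n : ℕ, ∀ j, h - (u (σ j)).card = n → c j = 0 := by
      intro n
      induction n using Nat.strong_induction_on with
      | _ n ih =>
        intro j hn
        have hsum := h0 (σ j)
        rw [← Finset.add_sum_erase _ _ (Finset.mem_univ j)] at hsum
        have hrest : ∑ j' ∈ (Finset.univ : Finset (Fin r)).erase j, M (σ j) j' * c j' = 0 := by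
          refine Finset.sum_eq_zero fun j' hj' => ?_
          have hne : j' ≠ j := (Finset.mem_erase.mp hj').1
          by_cases hz : M (σ j) j' = 0
          · rw [hz, zero_mul]
          · have hsub : u (σ j) ⊆ u (σ j') := hM _ _ hz
            have hne' : u (σ j) ≠ u (σ j') := fun e => hne (σ.injective (hu e)).symm
            have hlt : (u (σ j)).card < (u (σ j')).card :=
              Finset.card_lt_card (lt_of_le_of_ne hsub hne')
            have hle : (u (σ j')).card ≤ h := (Finset.card_le_univ _).trans (Fintype.card_fin h).le
            rw [ih (h - (u (σ j')).card) (by omega) j' rfl, mul_zero]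
        rw [hrest, add_zero] at hsum
        exact (mul_eq_zero.mp hsum).resolve_left (hdiag j)
    funext j
    exact hind _ j rfl
  have hu' := Matrix.mulVec_injective_iff_isUnit.mp hinj
  exact ((Matrix.isUnit_iff_isUnit_det _).mp hu').ne_zero

/-- Sums over the sub-faces of a row of a lower-set family are sums over the rows below it. -/
theorem sum_powerset_eq_sum_rows {K : Type*} [AddCommMonoid K] {r : ℕ} (u : Fin r → Finset (Fin h))
    (hu : Function.Injective u) (hlow : ∀ i S, S ⊆ u i → ∃ k, u k = S) (i : Fin r)
    (f : Finset (Fin h) → K) :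
    ∑ S ∈ (u i).powerset, f S = ∑ k, if u k ⊆ u i then f (u k) else 0 := by
  classical
  rw [← Finset.sum_filter]
  have himg : (u i).powerset = (Finset.univ.filter fun k => u k ⊆ u i).image u := by
    ext S
    rw [Finset.mem_powerset, Finset.mem_image]
    constructor
    · intro hS
      obtain ⟨k, hk⟩ := hlow i S hS
      exact ⟨k, Finset.mem_filter.mpr ⟨Finset.mem_univ _, by rw [hk]; exact hS⟩, hk⟩
    · rintro ⟨k, hk, rfl⟩
      exact (Finset.mem_filter.mp hk).2
  rw [himg, Finset.sum_image (fun k _ k' _ e => hu e)]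

/-! ## 4. The leading matrix -/

/-- **The leading matrix of the face-private design is nonsingular.** Rows `u` injective with
lower-set range, labels `V j = u (σ j)` for a permutation `σ`, exponents `n j` with
`n j = 0 ⇒ V j = ∅`; `Q j = (1 − X_{V j})^{n j}`. Then `det [coeff_{x^{u i}} ∏_{j' ≠ j} Q j'] ≠ 0`. -/
theorem det_leadingMatrix_ne_zero {r : ℕ} (u : Fin r → Finset (Fin h)) (hu : Function.Injective u)
    (hlow : ∀ i S, S ⊆ u i → ∃ k, u k = S) (σ : Equiv.Perm (Fin r)) (n : Fin r → ℕ)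
    (hn : ∀ j, n j = 0 → u (σ j) = ∅) :
    (Matrix.of fun i j : Fin r => coeff (∑ a ∈ u i, Finsupp.single (Fin.castAdd h a) 1 +
        ∑ c ∈ (∅ : Finset (Fin h)), Finsupp.single (Fin.natAdd h c) 1)
      (∏ j' ∈ (Finset.univ : Finset (Fin r)).erase j,
        ((1 + C (-1 : ℂ) * ∑ a ∈ u (σ j'), X (Fin.castAdd h a)) ^ (n j') :
          MvPolynomial (Fin (h + h)) ℂ))).det ≠ 0 := by
  classical
  -- notation-free abbreviations
  set Q : Fin r → MvPolynomial (Fin (h + h)) ℂ := fun j' =>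
    (1 + C (-1 : ℂ) * ∑ a ∈ u (σ j'), X (Fin.castAdd h a)) ^ (n j') with hQdef
  set Qall : MvPolynomial (Fin (h + h)) ℂ := ∏ j', Q j' with hQall
  -- the truncated inverses
  set Tr : Fin r → MvPolynomial (Fin (h + h)) ℂ := fun j =>
    if n j = 0 then 1 else
      ∑ i ∈ Finset.range ((u (σ j)).card + 1), C (((((n j - 1) + i).choose (n j - 1) : ℕ) : ℂ)) *
        (∑ a ∈ u (σ j), X (Fin.castAdd h a)) ^ i with hTr
  -- Step A: `coeff_{x^U} ∏_{j'≠j} Q j' = coeff_{x^U} (Tr j * Qall)`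
  have stepA : ∀ (j : Fin r) (U : Finset (Fin h)),
      coeff (∑ a ∈ U, Finsupp.single (Fin.castAdd h a) 1 +
          ∑ c ∈ (∅ : Finset (Fin h)), Finsupp.single (Fin.natAdd h c) 1) (∏ j' ∈ Finset.univ.erase j, Q j') =
      coeff (∑ a ∈ U, Finsupp.single (Fin.castAdd h a) 1 +
          ∑ c ∈ (∅ : Finset (Fin h)), Finsupp.single (Fin.natAdd h c) 1) (Tr j * Qall) := by
    intro j U
    by_cases hnj : n j = 0
    · have hQj : Q j = 1 := by simp only [hQdef, hnj, pow_zero]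
      rw [hTr]
      simp only [hnj, if_true, one_mul]
      rw [hQall, Finset.prod_erase _ hQj]
    · rw [hTr]
      simp only [hnj, if_false]
      obtain ⟨d, hd⟩ := Nat.exists_eq_succ_of_ne_zero hnj
      have hQj : Q j = (1 + C (-1 : ℂ) * ∑ a ∈ u (σ j), X (Fin.castAdd h a)) ^ (d + 1) := by
        simp only [hQdef, hd]
      have hsplit : Qall = (∏ j' ∈ Finset.univ.erase j, Q j') * Q j := by
        rw [hQall, Finset.prod_erase_mul _ _ (Finset.mem_univ j)]
      rw [show n j - 1 = d by omega, mul_comm, hsplit, mul_assoc, hQj]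
      exact (coeff_partitionExpo_mul_oneSubSumX_pow_mul_truncInv _ _ _ _ _).symm
  -- square-free coefficients of the truncated inverses
  have hTrcoeff : ∀ (j : Fin r) (S : Finset (Fin h)),
      coeff (∑ a ∈ S, Finsupp.single (Fin.castAdd h a) 1 +
          ∑ c ∈ (∅ : Finset (Fin h)), Finsupp.single (Fin.natAdd h c) 1) (Tr j) =
      if S ⊆ u (σ j) then (((((n j - 1) + S.card).choose (n j - 1)) * S.card.factorial : ℕ) : ℂ)
      else 0 := by
    intro j S
    by_cases hnj : n j = 0
    · rw [hTr]
      simp only [hnj, if_true]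
      rw [coeff_partitionExpo_one ℂ, hn j hnj]
      by_cases hS : S = ∅
      · subst hS; simp
      · rw [if_neg (fun hh => hS hh.1), if_neg (fun hh => hS (Finset.subset_empty.mp hh))]
    · rw [hTr]
      simp only [hnj, if_false]
      rw [coeff_partitionExpo_truncInv]
      by_cases hS : S ⊆ u (σ j)
      · rw [if_pos ⟨rfl, hS, Finset.card_le_card hS⟩, if_pos hS]
      · rw [if_neg (fun hh => hS hh.2.1), if_neg hS]
  -- Step B/C: the factorisation `A = M_Q · T`
  set Mq : Matrix (Fin r) (Fin r) ℂ := Matrix.of fun i k =>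
    if u k ⊆ u i then coeff (∑ a ∈ u i \ u k, Finsupp.single (Fin.castAdd h a) 1 +
      ∑ c ∈ (∅ : Finset (Fin h)), Finsupp.single (Fin.natAdd h c) 1) Qall else 0 with hMq
  set Tm : Matrix (Fin r) (Fin r) ℂ := Matrix.of fun k j =>
    coeff (∑ a ∈ u k, Finsupp.single (Fin.castAdd h a) 1 +
      ∑ c ∈ (∅ : Finset (Fin h)), Finsupp.single (Fin.natAdd h c) 1) (Tr j) with hTm
  have hfac : (Matrix.of fun i j : Fin r => coeff (∑ a ∈ u i, Finsupp.single (Fin.castAdd h a) 1 +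
        ∑ c ∈ (∅ : Finset (Fin h)), Finsupp.single (Fin.natAdd h c) 1)
      (∏ j' ∈ (Finset.univ : Finset (Fin r)).erase j, Q j')) = Mq * Tm := by
    ext i j
    rw [Matrix.of_apply, stepA j (u i), coeff_partitionExpo_mul, Matrix.mul_apply]
    simp only [Finset.powerset_empty, Finset.sum_singleton, Finset.sdiff_self]
    rw [sum_powerset_eq_sum_rows u hu hlow i]
    refine Finset.sum_congr rfl fun k _ => ?_
    rw [hMq, hTm, Matrix.of_apply, Matrix.of_apply]
    by_cases hk : u k ⊆ u i
    · rw [if_pos hk, if_pos hk, mul_comm]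
    · rw [if_neg hk, if_neg hk, zero_mul]
  rw [hfac, Matrix.det_mul]
  refine mul_ne_zero ?_ ?_
  · -- `M_Q` is lower triangular along `⊆` with diagonal `Qall_∅ = 1`
    refine det_ne_zero_of_lowerTriangular_subset u hu Mq (fun i k hik => ?_) (fun i => ?_)
    · by_contra hsub
      rw [hMq, Matrix.of_apply, if_neg hsub] at hik
      exact hik rfl
    · rw [hMq, Matrix.of_apply, if_pos (subset_refl _), Finset.sdiff_self,
        Finset.sum_empty, Finset.sum_empty, add_zero, ← MvPolynomial.constantCoeff_eq, hQall, map_prod]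
      rw [Finset.prod_eq_one]
      · exact one_ne_zero
      · intro j' _
        rw [hQdef]
        simp only [map_pow, map_add, map_one, map_mul, constantCoeff_C, map_sum, constantCoeff_X,
          Finset.sum_const_zero, mul_zero, add_zero, one_pow]
  · -- `T` is upper triangular along `⊆` (through `σ`) with nonzero diagonal
    refine det_ne_zero_of_upperTriangular_subset u hu σ Tm (fun k j hkj => ?_) (fun j => ?_)
    · by_contra hsub
      rw [hTm, Matrix.of_apply, hTrcoeff, if_neg hsub] at hkj
      exact hkj rfl
    · rw [hTm, Matrix.of_apply, hTrcoeff, if_pos (subset_refl _), Nat.cast_ne_zero]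
      exact Nat.mul_ne_zero (Nat.choose_pos (by omega)).ne' (Nat.factorial_ne_zero _)

end

end Summit.ValiantsHypothesis.ValiantsHypothesis.Theorems.BarrierLever.ChowFacePrivate
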